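import Summits.HodgeConjecture.HodgeConjecture.Theses.CyclicUnitaryPowers

/-!
# K2 eigen-Hodge numbers, affine relation (route `CyclicUnitaryPowers`, item stmt-HodgeConjecture-19545)

Discharges the registered stub `stub_eigenHodgeNumbersAffine` (skeleton `3dcaec2ceafa0764`, K2 line
`unitary-kunneth-fft`, stub W) of crux `PowersHodgeOfDeckCommutators` (rank 3) of route
`route-HodgeConjecture-CyclicUnitaryPowers`; landed `--supports stmt-HodgeConjecture-19545` (it does not
close the item). Sorry-free; pure combinatorics.

## Statement

`stub_eigenHodgeNumbersAffine` (registered signature verbatim, with the route's `let`-prefix `pmul`, `ehn`):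
for every prime `p ≥ 7` and `1 ≤ j < p`,
`2 · (e_{j,0} − e_{j,2}) = (p − 3)(p − 2j)` in `ℤ`, where `e_{j,q} = ehn p j q` is the coefficient of
`t^{(q+1)p − 3 − j}` in `(1 + t + ⋯ + t^{p−2})³` (the list `cube p` is computed by the Cauchy product
`pmul` of coefficient lists) — the eigen-Hodge numbers `h^{2−q,q}_{ζ^j}` of the `p`-cyclic plane
`X_f : x₃^p = f(x₀,x₁,x₂)` (Griffiths–Dolgachev residues; only the combinatorial identity is proved here).

## Proof

`cauchy_getD`: the `k`-th entry of `pmul a b` is `Σ_{i ≤ k} aᵢ b_{k−i}` (for ALL `k`, entries past the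
length being `0`). With `R = (1,…,1)` (`p − 1` ones): `c₁ = pmul [1] R = R`; `c₂ = pmul c₁ R` has
`c₂(i) = i + 1` for `i < p − 1` and `c₂(i) = (p−1) − (i+2−p)` for `i ≥ p − 1` (a filter of `range` is an
`Ico`); `c₃ = cube` has `2·c₃(m) = (m+1)(m+2)` for `m < p − 1` (Gauss) and
`2·c₃(3(p−1) − j) = (j−2)(j−1)` for `1 ≤ j ≤ p − 1` (an `Ico`-reindexing plus Gauss). Hence
`2 e_{j,0} = (p−2−j)(p−1−j)` and `2 e_{j,2} = (j−2)(j−1)` in `ℕ` (truncated subtraction included), and the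
identity follows in `ℤ` by `linear_combination`.

## References

Context only (nothing is imported from it): I. Dolgachev, *Weighted projective varieties*, Lecture Notes
in Math. 956 (1982), §4 — Steenbrink–Griffiths residues for quasi-smooth weighted hypersurfaces, the source
of the eigen-Hodge-number formula that the route's `ehn` encodes. All statements below are elementary
(`[folklore]`).
-/

namespace Summit.HodgeConjecture.HodgeConjecture.Theorems.CyclicUnitaryPowersEigenHodgeNumbersAffine

open Finset

/-- A list sum over `List.range` is the `Finset.range` sum. [folklore] -/
theorem list_sum_map_range_eq (f : ℕ → ℕ) (n : ℕ) :
    ((List.range n).map f).sum = ∑ i ∈ range n, f i := by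
  induction n with
  | zero => simp
  | succ n ih => rw [List.range_succ, List.map_append, List.sum_append, ih, Finset.sum_range_succ]; simp

/-- **Coefficients of the Cauchy product** (the route's `pmul`, written out): entry `k` of `pmul a b` is
`Σ_{i ≤ k} aᵢ b_{k−i}` for every `k` (beyond the length both sides vanish). [folklore] -/
theorem cauchy_getD (a b : List ℕ) (k : ℕ) :
    ((List.range (a.length + b.length - 1)).map fun k =>
        ((List.range (k + 1)).map fun i => a.getD i 0 * b.getD (k - i) 0).sum).getD k 0 =
      ∑ i ∈ range (k + 1), a.getD i 0 * b.getD (k - i) 0 := by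
  rw [List.getD_eq_getElem?_getD, List.getElem?_map]
  by_cases h : k < a.length + b.length - 1
  · rw [List.getElem?_range h]
    exact list_sum_map_range_eq _ _
  · rw [List.getElem?_eq_none (by rw [List.length_range]; omega)]
    show 0 = _
    refine (Finset.sum_eq_zero fun i hi ↦ ?_).symm
    rw [Finset.mem_range] at hi
    by_cases hia : i < a.length
    · rw [List.getD_eq_getElem?_getD (l := b), List.getElem?_eq_none (by omega), Option.getD_none, mul_zero]
    · rw [List.getD_eq_getElem?_getD (l := a), List.getElem?_eq_none (by omega), Option.getD_none, zero_mul]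

/-- Entries of the all-ones list. [folklore] -/
theorem getD_replicate_one (n k : ℕ) : (List.replicate n 1).getD k 0 = if k < n then 1 else 0 := by
  rw [List.getD_eq_getElem?_getD, List.getElem?_replicate]
  split_ifs <;> rfl

/-- Entries of `[1]`. [folklore] -/
theorem getD_singleton_one (k : ℕ) : [1].getD k 0 = if k = 0 then 1 else 0 := by
  cases k <;> simp

/-- `2 Σ_{t<N} (c − t) = c(c+1)` for `c < N`. [folklore] -/
theorem two_mul_sum_range_tsub {c N : ℕ} (h : c < N) : 2 * ∑ t ∈ range N, (c - t) = c * (c + 1) := by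
  induction N with
  | zero => omega
  | succ N ih =>
    rcases Nat.lt_succ_iff_lt_or_eq.1 h with h' | h'
    · rw [Finset.sum_range_succ, show c - N = 0 by omega, add_zero, ih h']
    · subst h'
      have hrefl := Finset.sum_range_reflect (fun t => t) (c + 1)
      have hre : ∑ t ∈ range (c + 1), (c - t) = ∑ t ∈ range (c + 1), (c + 1 - 1 - t) :=
        Finset.sum_congr rfl fun t _ ↦ by omega
      have h2 := Finset.sum_range_id_mul_two (c + 1)
      rw [show c + 1 - 1 = c by omega] at h2
      rw [hre, hrefl, mul_comm, h2, mul_comm]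

section Cube

variable (pm : List ℕ → List ℕ → List ℕ)
  (hpm : ∀ a b, pm a b = (List.range (a.length + b.length - 1)).map fun k =>
    ((List.range (k + 1)).map fun i => a.getD i 0 * b.getD (k - i) 0).sum)
include hpm

/-- `c₁ = pmul [1] R = R`. [folklore] -/
theorem c1_getD (n k : ℕ) : (pm [1] (List.replicate n 1)).getD k 0 = if k < n then 1 else 0 := by
  rw [hpm, cauchy_getD, Finset.sum_range_succ', getD_singleton_one, if_pos rfl, one_mul, Nat.sub_zero,
    getD_replicate_one, Finset.sum_eq_zero fun i _ ↦ ?_, zero_add]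
  rw [getD_singleton_one, if_neg (Nat.succ_ne_zero i), zero_mul]

/-- `c₂ = pmul c₁ R` counts `{i₁ ≤ i : i₁ < n, i − i₁ < n}`. [folklore] -/
theorem c2_getD (n i : ℕ) :
    (pm (pm [1] (List.replicate n 1)) (List.replicate n 1)).getD i 0 =
      ((range (i + 1)).filter fun i1 => i1 < n ∧ i - i1 < n).card := by
  rw [hpm (pm [1] (List.replicate n 1)) (List.replicate n 1), cauchy_getD, Finset.card_filter]
  refine Finset.sum_congr rfl fun i1 _ ↦ ?_
  rw [c1_getD pm hpm, getD_replicate_one]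
  by_cases ha : i1 < n <;> by_cases hb : i - i1 < n <;> simp [ha, hb]

/-- Low range: `c₂(i) = i + 1` for `i < n`. [folklore] -/
theorem c2_getD_low {n i : ℕ} (hi : i < n) :
    (pm (pm [1] (List.replicate n 1)) (List.replicate n 1)).getD i 0 = i + 1 := by
  rw [c2_getD pm hpm, Finset.filter_true_of_mem fun i1 hi1 ↦ ?_, Finset.card_range]
  rw [Finset.mem_range] at hi1
  omega

/-- High range: `c₂(i) = n − (i + 1 − n)` for `i ≥ n` (so `0` for `i ≥ 2n − 1`). [folklore] -/
theorem c2_getD_high {n i : ℕ} (hi : n ≤ i) :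
    (pm (pm [1] (List.replicate n 1)) (List.replicate n 1)).getD i 0 = n - (i + 1 - n) := by
  rw [c2_getD pm hpm]
  have hS : (range (i + 1)).filter (fun i1 => i1 < n ∧ i - i1 < n) = Finset.Ico (i + 1 - n) n := by
    ext x
    simp only [Finset.mem_filter, Finset.mem_range, Finset.mem_Ico]
    omega
  rw [hS, Nat.card_Ico]

/-- Low range of the cube: `2 c₃(m) = (m+1)(m+2)` for `m < n`. [folklore] -/
theorem two_mul_c3_getD_low {n m : ℕ} (hm : m < n) :
    2 * (pm (pm (pm [1] (List.replicate n 1)) (List.replicate n 1)) (List.replicate n 1)).getD m 0 =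
      (m + 1) * (m + 2) := by
  rw [hpm (pm (pm [1] (List.replicate n 1)) (List.replicate n 1)) (List.replicate n 1), cauchy_getD]
  have hsum : ∑ i ∈ range (m + 1), (pm (pm [1] (List.replicate n 1)) (List.replicate n 1)).getD i 0 *
      (List.replicate n 1).getD (m - i) 0 = ∑ i ∈ range (m + 1), (i + 1) := by
    refine Finset.sum_congr rfl fun i hi ↦ ?_
    rw [Finset.mem_range] at hi
    rw [c2_getD_low pm hpm (by omega), getD_replicate_one, if_pos (by omega), mul_one]
  have hG := Finset.sum_range_succ' (fun i => i) (m + 1)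
  rw [add_zero] at hG
  have h2 := Finset.sum_range_id_mul_two (m + 2)
  rw [hG, show m + 2 - 1 = m + 1 by omega] at h2
  rw [hsum, mul_comm, h2, mul_comm]

/-- High range of the cube: `2 c₃(3n − j) = (j−2)(j−1)` for `1 ≤ j ≤ n`. [folklore] -/
theorem two_mul_c3_getD_high {n j : ℕ} (hj1 : 1 ≤ j) (hjn : j ≤ n) :
    2 * (pm (pm (pm [1] (List.replicate n 1)) (List.replicate n 1)) (List.replicate n 1)).getD
        (3 * n - j) 0 = (j - 2) * (j - 1) := by
  rw [hpm (pm (pm [1] (List.replicate n 1)) (List.replicate n 1)) (List.replicate n 1), cauchy_getD]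
  have hterm : ∀ i ∈ range (3 * n - j + 1),
      (pm (pm [1] (List.replicate n 1)) (List.replicate n 1)).getD i 0 *
          (List.replicate n 1).getD (3 * n - j - i) 0 =
        if 2 * n + 1 - j ≤ i then n - (i + 1 - n) else 0 := by
    intro i hi
    rw [Finset.mem_range] at hi
    rw [getD_replicate_one]
    split_ifs with h1 h2 <;>
      first | (exfalso; omega) | rw [mul_zero] | rw [mul_one, c2_getD_high pm hpm (by omega)]
  rw [Finset.sum_congr rfl hterm, ← Finset.sum_filter]
  have hS : (range (3 * n - j + 1)).filter (fun i => 2 * n + 1 - j ≤ i) =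
      Finset.Ico (2 * n + 1 - j) (3 * n - j + 1) := by
    ext x
    simp only [Finset.mem_filter, Finset.mem_range, Finset.mem_Ico]
    omega
  rw [hS, Finset.sum_Ico_eq_sum_range, show 3 * n - j + 1 - (2 * n + 1 - j) = n by omega]
  have hre : ∑ t ∈ range n, (n - (2 * n + 1 - j + t + 1 - n)) = ∑ t ∈ range n, (j - 2 - t) :=
    Finset.sum_congr rfl fun t _ ↦ by omega
  rw [hre, two_mul_sum_range_tsub (by omega : j - 2 < n)]
  rcases Nat.lt_or_ge j 2 with h | h
  · rw [show j - 2 = 0 by omega, zero_mul, zero_mul]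
  · rw [show j - 2 + 1 = j - 1 by omega]

end Cube

/-- **`stub_eigenHodgeNumbersAffine`** (registered signature verbatim): `2(e_{j,0} − e_{j,2}) = (p−3)(p−2j)`.
[folklore] -/
theorem stub_eigenHodgeNumbersAffine :
    open Literature.AlgebraicGeometry.Motives Literature.AlgebraicGeometry.HodgeTheory Literature.AlgebraicGeometry.HodgeTheory.BettiUniverse CategoryTheory.Limits in let pmul : List ℕ → List ℕ → List ℕ := fun a b => (List.range (a.length + b.length - 1)).map fun k => ((List.range (k + 1)).map fun i => a.getD i 0 * b.getD (k - i) 0).sum; let ehn : ℕ → ℕ → ℕ → ℕ := fun p j q => if (q + 1) * p < 3 + j then 0 else ((List.replicate 3 (List.replicate (p - 1) 1)).foldl pmul [1]).getD ((q + 1) * p - 3 - j) 0; ∀ p : ℕ, p.Prime → 7 ≤ p → ∀ j ∈ Finset.Ico 1 p, 2 * ((ehn p j 0 : ℤ) - (ehn p j 2 : ℤ)) = ((p : ℤ) - 3) * ((p : ℤ) - 2 * (j : ℤ)) := by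
  intro pmul ehn p hp h7 j hj
  have hpm : ∀ a b, pmul a b = (List.range (a.length + b.length - 1)).map fun k =>
      ((List.range (k + 1)).map fun i => a.getD i 0 * b.getD (k - i) 0).sum := fun a b => rfl
  rw [Finset.mem_Ico] at hj
  obtain ⟨hj1, hjp⟩ := hj
  have he0 : 2 * ehn p j 0 = (p - 2 - j) * (p - 1 - j) := by
    show 2 * (if (0 + 1) * p < 3 + j then 0 else
      ((List.replicate 3 (List.replicate (p - 1) 1)).foldl pmul [1]).getD ((0 + 1) * p - 3 - j) 0) = _
    by_cases hlt : (0 + 1) * p < 3 + j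
    · rw [if_pos hlt, mul_zero, show p - 2 - j = 0 by omega, zero_mul]
    · rw [if_neg hlt, show (0 + 1) * p - 3 - j = p - 3 - j by omega]
      show 2 * (pmul (pmul (pmul [1] (List.replicate (p - 1) 1)) (List.replicate (p - 1) 1))
        (List.replicate (p - 1) 1)).getD (p - 3 - j) 0 = _
      rw [two_mul_c3_getD_low pmul hpm (by omega : p - 3 - j < p - 1),
        show p - 3 - j + 1 = p - 2 - j by omega, show p - 3 - j + 2 = p - 1 - j by omega]
  have he2 : 2 * ehn p j 2 = (j - 2) * (j - 1) := by
    show 2 * (if (2 + 1) * p < 3 + j then 0 else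
      ((List.replicate 3 (List.replicate (p - 1) 1)).foldl pmul [1]).getD ((2 + 1) * p - 3 - j) 0) = _
    rw [if_neg (by omega), show (2 + 1) * p - 3 - j = 3 * (p - 1) - j by omega]
    show 2 * (pmul (pmul (pmul [1] (List.replicate (p - 1) 1)) (List.replicate (p - 1) 1))
      (List.replicate (p - 1) 1)).getD (3 * (p - 1) - j) 0 = _
    exact two_mul_c3_getD_high pmul hpm hj1 (by omega : j ≤ p - 1)
  -- pass to `ℤ`
  have h0z : 2 * (ehn p j 0 : ℤ) = ((p : ℤ) - 2 - j) * ((p : ℤ) - 1 - j) := by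
    rcases Nat.lt_or_ge j (p - 1) with hjs | hjs
    · have hc := congrArg (Nat.cast : ℕ → ℤ) he0
      rw [Nat.sub_sub, Nat.sub_sub] at hc
      push_cast [Nat.cast_sub (show 2 + j ≤ p by omega), Nat.cast_sub (show 1 + j ≤ p by omega)] at hc
      rw [hc]; ring
    · have hj' : j = p - 1 := by omega
      have h00 : ehn p j 0 = 0 := by
        have : p - 2 - j = 0 := by omega
        rw [this, zero_mul] at he0; omega
      rw [h00, hj', Nat.cast_sub (by omega : 1 ≤ p)]
      push_cast
      ring
  have h2z : 2 * (ehn p j 2 : ℤ) = ((j : ℤ) - 2) * ((j : ℤ) - 1) := by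
    rcases Nat.lt_or_ge j 2 with hjs | hjs
    · have hj' : j = 1 := by omega
      have h20 : ehn p j 2 = 0 := by
        have : j - 1 = 0 := by omega
        rw [this, mul_zero] at he2; omega
      rw [h20, hj']
      norm_num
    · have hc := congrArg (Nat.cast : ℕ → ℤ) he2
      push_cast [Nat.cast_sub hjs, Nat.cast_sub (show 1 ≤ j by omega)] at hc
      rw [hc]
  linear_combination h0z - h2z

end Summit.HodgeConjecture.HodgeConjecture.Theorems.CyclicUnitaryPowersEigenHodgeNumbersAffine
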